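import Mathlib
import Summits.CriticalPhenomena.PercolationContinuityZ3.Theorems.PercNearOneGluingNoHeavyLowerTailTNKernels
import Literature.Analysis.TotalPositivity.PolyaFrequencyReciprocal
import Literature.Analysis.TotalPositivity.PolyaFrequencyDeflation
import HarnessLib

/-!
# Quadratic-row kernels: a chain-sequence criterion for total nonnegativity (THEOREM N₃-III, abstract core)

Support file for the Sahi / Conjecture-P programme of route `PercNearOneGluingNoHeavy`
(`--supports stmt-CriticalPhenomena-4575`, prover prim-l12-p5 gen 43; proof note
`prim-l12-p5/PROOF-THREE-RAYS-g43.md` §2 (LEMMA 2) and §3 (THEOREM N₃-III)).  No definitions, no named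
facts, no sorries.

The three-ray exp-arrays of the memo reduce (THEOREM R3 of gen 42) to kernels of the shape
`K(n,l) = A_n C(n,l) + B_n C(n-1,l) + C_n C(n-2,l)` — rows `(1+x)^{n-2}·(A_n (1+x)^2 + B_n (1+x) + C_n)`,
a "band matrix times Pascal".  The purely combinatorial heart of THEOREM N₃-III is:

**THEOREM (`bandTwo_choose_tn`).**  Let `A_n > 0` (`n ≥ 0`), `B_n > 0` (`n ≥ 1`), `C_n > 0` (`n ≥ 2`),
`B_0 = C_0 = C_1 = 0`, and suppose the chain condition `4 A_{n-1} C_n ≤ B_{n-1} B_n` (`n ≥ 2`).  Then `K` is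
totally nonnegative: every minor `det[K(r_i, c_j)]` with strictly increasing `r, c` is `≥ 0`.

Proof (memo §3): the minimal chain parameters stay `≤ 1/2`, i.e. the sequence
`σ_1 = B_1/A_1`, `σ_n = (B_n - C_n/σ_{n-1})/A_n` satisfies `σ_n ≥ B_n/(2A_n) > 0`; then
`K = 𝔅 · 𝔎̂` with `𝔅` lower bidiagonal (`A_n` on the diagonal, `C_n/σ_{n-1} ≥ 0` below it) and
`𝔎̂(j,l) = C(j,l) + σ_j C(j-1,l) = (bidiagonal(1; σ_j) · Pascal)(j,l)`; nonnegative bidiagonal kernels are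
Toeplitz minors of the Pólya frequency sequence `(1,1,0,…)` up to positive diagonal scalings, the Pascal
kernel is `i!·[1/(i-l)!]·(1/l!)` with `1/n!` a Pólya frequency sequence, and products of lower-triangular TN
kernels are TN (`TNKernel.mulLower_minor_nonneg`).
-/

namespace Summit.CriticalPhenomena.PercolationContinuityZ3.Theorems

namespace BandTwoTN

open Finset Matrix
open scoped Nat

open Literature.Analysis.TotalPositivity in
/-- The Toeplitz kernel of the Pólya frequency sequence `(1, β, 0, 0, …)` is the bidiagonal kernel
`[j = n] + β [j + 1 = n]`. -/
theorem seqZ_oneLinear (β : ℝ) (n j : ℕ) :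
    seqZ (mulLinear (fun k => if k = 0 then (1 : ℝ) else 0) β) ((n : ℤ) - j) =
      if j = n then 1 else if j + 1 = n then β else 0 := by
  rw [seqZ_natCast_sub_natCast]
  by_cases h1 : j = n
  · subst h1
    rw [if_pos le_rfl, if_pos rfl, Nat.sub_self, oneLinear_zero]
  by_cases h2 : j + 1 = n
  · subst h2
    rw [if_pos (by omega), if_neg h1, if_pos rfl, Nat.add_sub_cancel_left, oneLinear_one]
  by_cases h3 : j ≤ n
  · rw [if_pos h3, if_neg h1, if_neg h2]
    obtain ⟨k, hk⟩ : ∃ k, n - j = k + 2 := ⟨n - j - 2, by omega⟩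
    rw [hk, oneLinear_add_two]
  · rw [if_neg h3, if_neg h1, if_neg h2]

/-- **Nonnegative lower bidiagonal kernels with positive entries are totally nonnegative**:
`[j = n] d_n + [j + 1 = n] e_n` with `d_n > 0`, `e_n > 0` is `u_n · T(n,j) · v_j` for the Toeplitz kernel `T`
of the Pólya frequency sequence `(1,1,0,…)` and positive `u, v`. -/
theorem bidiag_minor_nonneg_of_pos (d e : ℕ → ℝ) (hd : ∀ n, 0 < d n) (he : ∀ n, 0 < e n)
    {k : ℕ} (r c : Fin k → ℕ) (hr : StrictMono r) (hc : StrictMono c) :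
    0 ≤ (Matrix.of fun i j =>
      if c j = r i then d (r i) else if c j + 1 = r i then e (r i) else 0).det := by
  -- v_0 = 1, v_{n+1} = d_{n+1} v_n / e_{n+1};  u_n = d_n / v_n
  let v : ℕ → ℝ := fun n => Nat.rec (motive := fun _ => ℝ) 1 (fun m w => d (m + 1) * w / e (m + 1)) n
  have hv0 : v 0 = 1 := rfl
  have hvs : ∀ m, v (m + 1) = d (m + 1) * v m / e (m + 1) := fun m => rfl
  have hvpos : ∀ n, 0 < v n := by
    intro n
    induction n with
    | zero => rw [hv0]; exact one_pos
    | succ m ih => rw [hvs]; exact div_pos (mul_pos (hd _) ih) (he _)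
  let u : ℕ → ℝ := fun n => d n / v n
  have hupos : ∀ n, 0 < u n := fun n => div_pos (hd n) (hvpos n)
  set K' : ℕ → ℕ → ℝ := fun n l =>
    Literature.Analysis.TotalPositivity.seqZ
      (Literature.Analysis.TotalPositivity.mulLinear (fun k => if k = 0 then (1 : ℝ) else 0) 1)
      ((n : ℤ) - l) with hK'
  have heq : (Matrix.of fun i j => if c j = r i then d (r i) else if c j + 1 = r i then e (r i) else 0) =
      Matrix.of fun i j => u (r i) * K' (r i) (c j) * v (c j) := by
    ext i j
    simp only [Matrix.of_apply, hK', seqZ_oneLinear]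
    by_cases h1 : c j = r i
    · rw [if_pos h1, if_pos h1, h1, mul_one]
      exact (div_mul_cancel₀ (d (r i)) (hvpos (r i)).ne').symm
    · rw [if_neg h1, if_neg h1]
      by_cases h2 : c j + 1 = r i
      · rw [if_pos h2, if_pos h2, mul_one, ← h2]
        show e (c j + 1) = d (c j + 1) / v (c j + 1) * v (c j)
        rw [hvs (c j)]
        have h3 := (hvpos (c j)).ne'
        have h4 := (he (c j + 1)).ne'
        have h5 := (hd (c j + 1)).ne'
        field_simp
      · rw [if_neg h2, if_neg h2, mul_zero, zero_mul]
  rw [heq, TNKernel.det_kernel_scale K' u v r c]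
  refine mul_nonneg (prod_nonneg fun i _ => (hupos _).le)
    (mul_nonneg (prod_nonneg fun j _ => (hvpos _).le) ?_)
  exact Literature.Analysis.TotalPositivity.isPolyaFrequencySeq_oneLinear zero_le_one k r c hr hc

/-- **Nonnegative lower bidiagonal kernels are totally nonnegative** (`d_n > 0`, `e_n ≥ 0`): limit of the
positive case. -/
theorem bidiag_minor_nonneg (d e : ℕ → ℝ) (hd : ∀ n, 0 < d n) (he : ∀ n, 0 ≤ e n)
    {k : ℕ} (r c : Fin k → ℕ) (hr : StrictMono r) (hc : StrictMono c) :
    0 ≤ (Matrix.of fun i j =>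
      if c j = r i then d (r i) else if c j + 1 = r i then e (r i) else 0).det := by
  let F : ℝ → ℝ := fun ε => (Matrix.of fun i j =>
      if c j = r i then d (r i) else if c j + 1 = r i then e (r i) + ε else (0 : ℝ)).det
  have hF : ∀ ε, 0 < ε → 0 ≤ F ε := fun ε hε =>
    bidiag_minor_nonneg_of_pos d (fun n => e n + ε) hd (fun n => add_pos_of_nonneg_of_pos (he n) hε)
      r c hr hc
  have hcont : Continuous F := by
    refine Continuous.matrix_det ?_
    refine continuous_pi fun i => continuous_pi fun j => ?_
    simp only [Matrix.of_apply]
    split_ifs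
    · exact continuous_const
    · exact continuous_const.add continuous_id
    · exact continuous_const
  have hF0 : F 0 = (Matrix.of fun i j =>
      if c j = r i then d (r i) else if c j + 1 = r i then e (r i) else 0).det := by
    simp only [F, add_zero]
  rw [← hF0]
  have hlim : Filter.Tendsto F (nhdsWithin 0 (Set.Ioi 0)) (nhds (F 0)) :=
    (hcont.tendsto 0).mono_left nhdsWithin_le_nhds
  exact ge_of_tendsto hlim (eventually_nhdsWithin_of_forall fun ε hε => hF ε hε)

/-- **The Pascal kernel `(i,l) ↦ C(i,l)` is totally nonnegative**: `C(i,l) = i! · [1/(i-l)!] · (1/l!)` and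
`1/n!` is a Pólya frequency sequence (`e^z`). -/
theorem choose_minor_nonneg {k : ℕ} (r c : Fin k → ℕ) (hr : StrictMono r) (hc : StrictMono c) :
    0 ≤ (Matrix.of fun i j => ((r i).choose (c j) : ℝ)).det := by
  set K' : ℕ → ℕ → ℝ := fun n l =>
    Literature.Analysis.TotalPositivity.seqZ (fun n => (1 : ℝ) ^ n / n !) ((n : ℤ) - l) with hK'
  have heq : (Matrix.of fun i j => ((r i).choose (c j) : ℝ)) =
      Matrix.of fun i j => ((r i)! : ℝ) * K' (r i) (c j) * ((c j)! : ℝ)⁻¹ := by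
    ext i j
    simp only [Matrix.of_apply, hK', Literature.Analysis.TotalPositivity.seqZ_natCast_sub_natCast, one_pow]
    by_cases h : c j ≤ r i
    · rw [if_pos h, Nat.choose_eq_factorial_div_factorial h,
        Nat.cast_div (Nat.factorial_mul_factorial_dvd_factorial h) (by positivity), Nat.cast_mul]
      field_simp
    · rw [if_neg h, Nat.choose_eq_zero_of_lt (by omega)]
      simp
  rw [heq, TNKernel.det_kernel_scale K' (fun n => ((n ! : ℕ) : ℝ)) (fun l => ((l ! : ℕ) : ℝ)⁻¹) r c]
  refine mul_nonneg (prod_nonneg fun i _ => by positivity)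
    (mul_nonneg (prod_nonneg fun j _ => by positivity) ?_)
  exact Literature.Analysis.TotalPositivity.isPolyaFrequencySeq_exp zero_le_one k r c hr hc

/-- Sums against a lower bidiagonal kernel: `Σ_{t ≤ n} ([t = n] a_n + [t + 1 = n] b_n) X_t = a_n X_n + b_n X_{n-1}`
for `n ≥ 1`, and `= a_0 X_0` for `n = 0` (stated with `b_0 X_{0-1}` harmlessly present: we assume `b_0 = 0`). -/
theorem sum_bidiag (a b X : ℕ → ℝ) (hb : b 0 = 0) (n : ℕ) :
    ∑ t ∈ range (n + 1), (if t = n then a n else if t + 1 = n then b n else 0) * X t =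
      a n * X n + b n * X (n - 1) := by
  cases n with
  | zero => simp [hb]
  | succ m =>
    rw [sum_range_succ, sum_range_succ, if_pos rfl, if_neg (by omega), if_pos rfl,
      Nat.add_sub_cancel]
    have h0 : ∑ t ∈ range m, (if t = m + 1 then a (m + 1) else if t + 1 = m + 1 then b (m + 1) else 0) * X t
        = 0 := by
      refine sum_eq_zero fun t ht => ?_
      rw [mem_range] at ht
      rw [if_neg (by omega), if_neg (by omega), zero_mul]
    rw [h0, zero_add, add_comm]

/-- **The rows `(1+x)^{j-1}(x + 1 + σ_j)`**: for `σ_0 = 0` and `σ_j > 0` (`j ≥ 1`) the kernel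
`𝔎̂(j,l) = C(j,l) + σ_j C(j-1,l)` is totally nonnegative (bidiagonal `(1; σ_j)` times Pascal). -/
theorem chooseShift_minor_nonneg (σ : ℕ → ℝ) (hσ0 : σ 0 = 0) (hσ : ∀ j, 1 ≤ j → 0 < σ j)
    {k : ℕ} (r c : Fin k → ℕ) (hr : StrictMono r) (hc : StrictMono c) :
    0 ≤ (Matrix.of fun i j => ((r i).choose (c j) : ℝ) + σ (r i) * (((r i) - 1).choose (c j) : ℝ)).det := by
  have heq : (Matrix.of fun i j => ((r i).choose (c j) : ℝ) + σ (r i) * (((r i) - 1).choose (c j) : ℝ)) =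
      Matrix.of fun i j => ∑ t ∈ range (r i + 1),
        (if t = r i then (1 : ℝ) else if t + 1 = r i then σ (r i) else 0) * ((t.choose (c j) : ℕ) : ℝ) := by
    ext i j
    rw [Matrix.of_apply, Matrix.of_apply,
      sum_bidiag (fun _ => (1 : ℝ)) σ (fun t => ((t.choose (c j) : ℕ) : ℝ)) hσ0 (r i), one_mul]
  rw [heq]
  set N := (univ.sup r) + (univ.sup c) + 1 with hN
  refine TNKernel.mulLower_minor_nonneg
    (fun n t => if t = n then (1 : ℝ) else if t + 1 = n then σ n else 0)
    (fun t l => ((t.choose l : ℕ) : ℝ)) N ?_ ?_ ?_ r c hr hc (fun i => ?_) (fun j => ?_)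
  · intro k' r' c' hr' hc'
    have hσnn : ∀ n, 0 ≤ σ n := by
      intro n
      rcases Nat.eq_zero_or_pos n with h | h
      · rw [h, hσ0]
      · exact (hσ n h).le
    exact bidiag_minor_nonneg (fun _ => 1) σ (fun _ => one_pos) hσnn r' c' hr' hc'
  · intro k' r' c' hr' hc' _ _
    exact choose_minor_nonneg r' c' hr' hc'
  · intro n t hnt
    rw [if_neg (by omega), if_neg (by omega)]
  · have : r i ≤ univ.sup r := Finset.le_sup (f := r) (mem_univ i)
    omega
  · have : c j ≤ univ.sup c := Finset.le_sup (f := c) (mem_univ j)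
    omega

/-- **The chain-sequence bound.**  If `A_n > 0`, `B_n > 0` (`n ≥ 1`), `C_n ≥ 0` and
`4 A_{n-1} C_n ≤ B_{n-1} B_n` (`n ≥ 2`), then any sequence with `σ_1 = B_1/A_1` and
`σ_n = (B_n - C_n/σ_{n-1})/A_n` (`n ≥ 2`) satisfies `σ_n ≥ B_n/(2A_n)` (hence `σ_n > 0`) for `n ≥ 1`:
the minimal parameters of the chain sequence `A_{n-1}C_n/(B_{n-1}B_n) ≤ 1/4` stay `≤ 1/2`. -/
theorem sigma_lower_bound (A B C σ : ℕ → ℝ) (hA : ∀ n, 0 < A n) (hB : ∀ n, 1 ≤ n → 0 < B n)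
    (hC : ∀ n, 0 ≤ C n) (hchain : ∀ n, 2 ≤ n → 4 * (A (n - 1) * C n) ≤ B (n - 1) * B n)
    (hσ1 : σ 1 = B 1 / A 1) (hσ : ∀ n, 2 ≤ n → σ n = (B n - C n / σ (n - 1)) / A n) :
    ∀ n, 1 ≤ n → B n / (2 * A n) ≤ σ n := by
  intro n hn
  induction n, hn using Nat.le_induction with
  | base =>
    rw [hσ1]
    have hA1 := hA 1; have hB1 := hB 1 le_rfl
    rw [div_le_div_iff₀ (by positivity) hA1]
    nlinarith
  | succ m hm ih =>
    have hAm := hA m; have hBm := hB m hm; have hA1 := hA (m + 1); have hB1 := hB (m + 1) (by omega)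
    have hσm : 0 < σ m := lt_of_lt_of_le (by positivity) ih
    rw [hσ (m + 1) (by omega), Nat.add_sub_cancel]
    have hc := hchain (m + 1) (by omega)
    rw [Nat.add_sub_cancel] at hc
    -- C_{m+1}/σ_m ≤ 2 A_m C_{m+1}/B_m ≤ B_{m+1}/2
    have h1 : C (m + 1) / σ m ≤ C (m + 1) / (B m / (2 * A m)) :=
      div_le_div_of_nonneg_left (hC _) (by positivity) ih
    have h2 : C (m + 1) / (B m / (2 * A m)) = 2 * (A m * C (m + 1)) / B m := by
      rw [div_div_eq_mul_div]
      ring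
    have h3 : 2 * (A m * C (m + 1)) / B m ≤ B (m + 1) / 2 := by
      rw [div_le_div_iff₀ hBm two_pos]
      nlinarith
    rw [div_le_div_iff₀ (by positivity) hA1]
    have h4 : C (m + 1) / σ m ≤ B (m + 1) / 2 := le_trans h1 (h2 ▸ h3)
    nlinarith

/-- **THEOREM N₃-III, abstract core (chain-sequence criterion).**  Let `A_n > 0`, `B_n > 0` (`n ≥ 1`),
`C_n ≥ 0`, `B_0 = C_0 = C_1 = 0`, and `4 A_{n-1} C_n ≤ B_{n-1} B_n` for `n ≥ 2`.  Then the quadratic-row kernel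
`K(n,l) = A_n C(n,l) + B_n C(n-1,l) + C_n C(n-2,l)` (rows `(1+x)^{n-2}(A_n(1+x)^2 + B_n(1+x) + C_n)`) is
totally nonnegative. -/
theorem bandTwo_choose_tn (A B C : ℕ → ℝ) (hA : ∀ n, 0 < A n) (hB : ∀ n, 1 ≤ n → 0 < B n) (hB0 : B 0 = 0)
    (hC : ∀ n, 0 ≤ C n) (hC0 : C 0 = 0) (hC1 : C 1 = 0)
    (hchain : ∀ n, 2 ≤ n → 4 * (A (n - 1) * C n) ≤ B (n - 1) * B n)
    {k : ℕ} (r c : Fin k → ℕ) (hr : StrictMono r) (hc : StrictMono c) :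
    0 ≤ (Matrix.of fun i j => A (r i) * ((r i).choose (c j) : ℝ) + B (r i) * (((r i) - 1).choose (c j) : ℝ)
      + C (r i) * (((r i) - 2).choose (c j) : ℝ)).det := by
  -- the sequence σ (two-step recursion, σ_0 := 0)
  let P : ℕ → ℝ × ℝ := fun n => Nat.rec (motive := fun _ => ℝ × ℝ) ((0 : ℝ), B 1 / A 1)
    (fun m p => (p.2, (B (m + 2) - C (m + 2) / p.2) / A (m + 2))) n
  let σ : ℕ → ℝ := fun n => (P n).1
  have hP : ∀ m, P (m + 1) = ((P m).2, (B (m + 2) - C (m + 2) / (P m).2) / A (m + 2)) := fun m => rfl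
  have hσ0 : σ 0 = 0 := rfl
  have hσ1 : σ 1 = B 1 / A 1 := rfl
  have hσ2 : ∀ n, 2 ≤ n → σ n = (B n - C n / σ (n - 1)) / A n := by
    intro n hn
    obtain ⟨m, rfl⟩ : ∃ m, n = m + 2 := ⟨n - 2, by omega⟩
    show (P (m + 2)).1 = (B (m + 2) - C (m + 2) / (P (m + 1)).1) / A (m + 2)
    rw [hP (m + 1), hP m]
  have hσpos : ∀ n, 1 ≤ n → 0 < σ n := fun n hn =>
    lt_of_lt_of_le (div_pos (hB n hn) (mul_pos two_pos (hA n)))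
      (sigma_lower_bound A B C σ hA hB hC hchain hσ1 hσ2 n hn)
  -- the left bidiagonal factor: diagonal A_n, subdiagonal q_n := C_n / σ_{n-1}
  let q : ℕ → ℝ := fun n => C n / σ (n - 1)
  have hq0 : q 0 = 0 := by show C 0 / σ (0 - 1) = 0; rw [hC0, zero_div]
  have hq1 : q 1 = 0 := by show C 1 / σ (1 - 1) = 0; rw [hC1, zero_div]
  have hqnn : ∀ n, 0 ≤ q n := by
    intro n
    rcases Nat.lt_or_ge n 2 with h | h
    · interval_cases n
      · rw [hq0]
      · rw [hq1]
    · exact div_nonneg (hC n) (hσpos (n - 1) (by omega)).le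
  -- K(n,l) = Σ_t 𝔅(n,t) 𝔎̂(t,l)
  have hrow : ∀ n l : ℕ, A n * (n.choose l : ℝ) + B n * ((n - 1).choose l : ℝ) + C n * ((n - 2).choose l : ℝ) =
      ∑ t ∈ range (n + 1), (if t = n then A n else if t + 1 = n then q n else 0) *
        ((t.choose l : ℝ) + σ t * ((t - 1).choose l : ℝ)) := by
    intro n l
    rw [sum_bidiag A q (fun t => (t.choose l : ℝ) + σ t * ((t - 1).choose l : ℝ)) hq0 n]
    rcases Nat.lt_or_ge n 2 with h | h
    · interval_cases n
      · simp [hσ0, hB0, hC0, hq0]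
      · have hA1 : A 1 ≠ 0 := (hA 1).ne'
        simp only [hσ1, hq1, hC1, Nat.sub_self, zero_mul, add_zero]
        field_simp
    · obtain ⟨m, rfl⟩ : ∃ m, n = m + 2 := ⟨n - 2, by omega⟩
      have e1 : (m + 2 - 1 : ℕ) = m + 1 := by omega
      have e2 : (m + 1 - 1 : ℕ) = m := by omega
      have e3 : (m + 2 - 2 : ℕ) = m := by omega
      have hs2 := hσ2 (m + 2) (by omega)
      rw [e1] at hs2
      have hsm : σ (m + 1) ≠ 0 := (hσpos (m + 1) (by omega)).ne'
      have hqm : q (m + 2) * σ (m + 1) = C (m + 2) := by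
        show C (m + 2) / σ (m + 2 - 1) * σ (m + 1) = C (m + 2)
        rw [e1]; exact div_mul_cancel₀ _ hsm
      have hAs : A (m + 2) * σ (m + 2) + q (m + 2) = B (m + 2) := by
        show A (m + 2) * σ (m + 2) + C (m + 2) / σ (m + 2 - 1) = B (m + 2)
        rw [e1, hs2, mul_div_cancel₀ _ (hA (m + 2)).ne']
        ring
      rw [e1, e2, e3]
      calc A (m + 2) * ((m + 2).choose l : ℝ) + B (m + 2) * ((m + 1).choose l : ℝ) + C (m + 2) * (m.choose l : ℝ)
          = A (m + 2) * ((m + 2).choose l : ℝ) + (A (m + 2) * σ (m + 2) + q (m + 2)) * ((m + 1).choose l : ℝ)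
              + (q (m + 2) * σ (m + 1)) * (m.choose l : ℝ) := by rw [hAs, hqm]
        _ = _ := by ring
  have heq : (Matrix.of fun i j => A (r i) * ((r i).choose (c j) : ℝ) + B (r i) * (((r i) - 1).choose (c j) : ℝ)
      + C (r i) * (((r i) - 2).choose (c j) : ℝ)) =
      Matrix.of fun i j => ∑ t ∈ range (r i + 1), (if t = r i then A (r i) else if t + 1 = r i then q (r i) else 0) *
        ((t.choose (c j) : ℝ) + σ t * ((t - 1).choose (c j) : ℝ)) := by
    ext i j
    rw [Matrix.of_apply, Matrix.of_apply, hrow]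
  rw [heq]
  set N := (univ.sup r) + (univ.sup c) + 1 with hN
  refine TNKernel.mulLower_minor_nonneg
    (fun n t => if t = n then A n else if t + 1 = n then q n else 0)
    (fun t l => (t.choose l : ℝ) + σ t * ((t - 1).choose l : ℝ)) N ?_ ?_ ?_ r c hr hc (fun i => ?_) (fun j => ?_)
  · intro k' r' c' hr' hc'
    exact bidiag_minor_nonneg A q hA hqnn r' c' hr' hc'
  · intro k' r' c' hr' hc' _ _
    exact chooseShift_minor_nonneg σ hσ0 hσpos r' c' hr' hc'
  · intro n t hnt
    rw [if_neg (by omega), if_neg (by omega)]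
  · have : r i ≤ univ.sup r := Finset.le_sup (f := r) (mem_univ i)
    omega
  · have : c j ≤ univ.sup c := Finset.le_sup (f := c) (mem_univ j)
    omega

/-- **Column-scaled form** (the dilated kernel of the memo, `M₃(n,l) = Σ_j R₃(n,j) c^l C(j,l)`): for `γ > 0`
the kernel `γ^l · K(n,l)` is totally nonnegative under the same hypotheses. -/
theorem bandTwo_choose_tn_scaled (A B C : ℕ → ℝ) (γ : ℝ) (hγ : 0 < γ) (hA : ∀ n, 0 < A n)
    (hB : ∀ n, 1 ≤ n → 0 < B n) (hB0 : B 0 = 0) (hC : ∀ n, 0 ≤ C n) (hC0 : C 0 = 0) (hC1 : C 1 = 0)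
    (hchain : ∀ n, 2 ≤ n → 4 * (A (n - 1) * C n) ≤ B (n - 1) * B n)
    {k : ℕ} (r c : Fin k → ℕ) (hr : StrictMono r) (hc : StrictMono c) :
    0 ≤ (Matrix.of fun i j => γ ^ (c j) * (A (r i) * ((r i).choose (c j) : ℝ)
      + B (r i) * (((r i) - 1).choose (c j) : ℝ) + C (r i) * (((r i) - 2).choose (c j) : ℝ))).det := by
  have heq : (Matrix.of fun i j => γ ^ (c j) * (A (r i) * ((r i).choose (c j) : ℝ)
      + B (r i) * (((r i) - 1).choose (c j) : ℝ) + C (r i) * (((r i) - 2).choose (c j) : ℝ))) =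
      Matrix.of fun i j => (1 : ℝ) * (A (r i) * ((r i).choose (c j) : ℝ)
        + B (r i) * (((r i) - 1).choose (c j) : ℝ) + C (r i) * (((r i) - 2).choose (c j) : ℝ)) * γ ^ (c j) := by
    ext i j; simp only [Matrix.of_apply]; ring
  rw [heq, TNKernel.det_kernel_scale (fun n l => A n * (n.choose l : ℝ) + B n * ((n - 1).choose l : ℝ)
    + C n * ((n - 2).choose l : ℝ)) (fun _ => (1 : ℝ)) (fun l => γ ^ l) r c]
  exact mul_nonneg (prod_nonneg fun _ _ => zero_le_one)
    (mul_nonneg (prod_nonneg fun _ _ => by positivity) (bandTwo_choose_tn A B C hA hB hB0 hC hC0 hC1 hchain r c hr hc))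

end BandTwoTN

end Summit.CriticalPhenomena.PercolationContinuityZ3.Theorems
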